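import Mathlib.FieldTheory.Relrank
import Literature.NumberTheory.EllipticCurves.IsogenySeparableFactorProofs
import Literature.NumberTheory.EllipticCurves.IsogenyCompProofs
import Literature.NumberTheory.EllipticCurves.IsogenyIdProofs
import Literature.NumberTheory.EllipticCurves.FrobeniusTateModuleProofs
import Literature.NumberTheory.EllipticCurves.FrobeniusSeparableProofs
import Literature.NumberTheory.EllipticCurves.TateModuleProjSurjectiveProofs
import Literature.NumberTheory.EllipticCurves.TateModuleProofs
import Literature.NumberTheory.EllipticCurves.GaloisActionProofs
import HarnessLib

/-!
# `deg(ψ ∘ φ) = deg ψ · deg φ`, and `det(φ_ℓ) = deg φ` (Silverman, *AEC*, Prop. III.8.6) from Cor. III.6.3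

Trunk T-ELLARITH (group G16); notion `cm_endomorphisms_isogeny`. Sibling *proofs* file of
`Literature.NumberTheory.EllipticCurves.IsogenyDegree` and
`Literature.NumberTheory.EllipticCurves.FrobeniusEndomorphism` (D-0014 append protocol; nothing
is defined here, all declarations are theorems). Two things are proved.

**(A) The tower law for the degree** `deg φ = [K̄(E) : φ^* K̄(E')]` of `IsogenyDegree` and the
composite isogeny `ψ.comp φ` of `IsogenyCompProofs`:

* `WeierstrassCurve.Isogeny.deg_comp : (ψ.comp φ).deg = ψ.deg * φ.deg`

(Silverman, *The Arithmetic of Elliptic Curves*, II.§2, p. 21: degrees of maps of curves are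
degrees of field extensions, multiplicative in towers; used throughout III.§6, e.g. in the proof of
Thm. III.6.2(a),(e): "`deg [m] = deg φ̂ · deg φ`"), with `deg [1] = 1` (`Isogeny.deg_id`) and the
same statements for the function `degHom` on `Hom_K` (`degHom_comp`, `degHom_id`).

**(B) Prop. III.8.6 from Cor. III.6.3.** The named fact
`WeierstrassCurve.Isogeny.det_tateModule_map_eq_deg W ℓ` of `FrobeniusEndomorphism` — Silverman,
Prop. III.8.6 (determinant part): *for `φ ∈ End_K(E)` and a prime `ℓ ≠ char K`, `det(φ_ℓ) = deg φ`
on `T_ℓ E`* — is **reduced to Cor. III.6.3** (`deg` is a quadratic form on `End_K(E)`: the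
named fact `WeierstrassCurve.degHom_isQuadraticForm W W` of `IsogenyDegree`, i.e. `deg(-f) = deg f`
and additivity of the polar form; positive definiteness is the tree's theorem `degHom_pos_holds`
of `IsogenyDegreeProofs`, and `deg 0 = 0` is `degHom_zero`):

* `WeierstrassCurve.Isogeny.det_tateModule_map_eq_deg_of_isQuadraticForm :
    degHom_isQuadraticForm W W → Isogeny.det_tateModule_map_eq_deg W ℓ`,

together with the trace part of III.8.6 in the form `tr(φ_ℓ) = deg(φ + 1) - deg φ - 1`
(`Isogeny.trace_tateModule_map_eq_of_isQuadraticForm`) and, for an elliptic curve over a finite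
field, the two named facts of `Literature.NumberTheory.EllipticCurves.FrobeniusTateModule`
(Silverman, Thm. V.2.3.1: `det(φ_ℓ) = q`, `tr(φ_ℓ) = q + 1 - #E(k)` for the Frobenius `φ`) from
Cor. III.6.3 and either the Weil pairings on `E[ℓ^n]` (Prop. III.8.1, the named fact
`exists_weilPairing`, used only for `det(φ_ℓ) = q`) or Prop. II.2.11(c) (`deg φ = q`, the named
fact `frobeniusIsogeny_deg_eq_card`): `trace_galoisRepTate_frobenius_of_isQuadraticForm`,
`det_galoisRepTate_frobenius_of_isQuadraticForm_of_deg`,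
`trace_galoisRepTate_frobenius_of_isQuadraticForm_of_deg`. Thm. III.4.10(a) and Cor. III.5.5, the
other inputs of Silverman's proof of V.2.3.1, are theorems of the tree
(`Isogeny.card_ker_eq_finSepDegree_holds`, `isSeparable_oneSubFrobeniusIsogeny_holds`).

## The proofs

**(A)** With the field embedding `φ^* : K̄(E') → K̄(E)` of `IsogenyDegreeKernelProofs`
(`Isogeny.pullbackHom`, with image `φ^* K̄(E') = Isogeny.pullbackField φ`) and the evaluation rule
`(φ^* z)(P) = z(φ P)` of `IsogenySeparableFactorProofs` (`HasValueAt.pullbackHom`,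
`Isogeny.hasValueAt_pullback_gen`):

* `(ψ ∘ φ)^* x'' = φ^* (ψ^* x'')` and likewise for `y''` (`pullbackX_comp`, `pullbackY_comp`): both
  sides are rational functions on `E` with the value `x''(ψ(φ P))` at all but finitely many
  `P ∈ E(K̄)` (the points where `ψ ∘ φ`, `φ` and — at `φ P` — `ψ` agree with their chosen rational
  representations), hence equal (`eq_of_infinite_setOf_hasValueAt`);
* hence `(ψ ∘ φ)^* K̄(E'') = φ^*(ψ^* K̄(E''))` (`pullbackField_comp`), and the tower
  `φ^*(ψ^* K̄(E'')) ⊆ φ^* K̄(E') ⊆ K̄(E)` with `[φ^* K̄(E') : φ^* ψ^* K̄(E'')] = [K̄(E') : ψ^* K̄(E'')]`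
  (`φ^*` is an isomorphism onto its image; Mathlib's `IntermediateField.relfinrank_map_map`) gives
  `deg (ψ ∘ φ) = deg ψ · deg φ` (`IntermediateField.relfinrank_mul_finrank_top`).

**(B)** (not Silverman's proof). Silverman proves III.8.6 with the Weil pairing
(`e(φx, φy) = e(x, φ̂φ y) = e(x, y)^{deg φ}`), i.e. with Prop. III.8.1–8.2 and the dual isogeny,
Thm. III.6.1–6.2. Here III.8.6 is derived from the *statement* of Cor. III.6.3 (a consequence of
III.6.2 in the book) by an argument in the spirit of Mumford, *Abelian Varieties*, §19, Thm. 4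
(`deg f = det T_ℓ f`, comparing both sides as functions on `End(A)`), elementary for `g = 1`:

1. **`φ² - tφ + deg φ = 0` in `End_K(E)`, `t = deg(φ + 1) - deg φ - 1 ∈ ℤ`**
   (`comp_self_sub_smul_add_smul_id_eq_zero`). The degree is multiplicative (A) and by III.6.3 a
   quadratic form with polar pairing `B(f, g) = deg(f + g) - deg f - deg g`. Linearising
   `deg(f ∘ g) = deg f · deg g` twice gives `B(f ∘ g, f ∘ h) = deg f · B(g, h)` and
   `B(f ∘ g, k ∘ h) + B(k ∘ g, f ∘ h) = B(f, k) B(g, h)`; with `k = 1`, `g = f` this is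
   `B(f² - B(f, 1) f + deg f, h) = 0` for all `h`, so `w = f² - B(f, 1) f + deg f` has
   `2 deg w = B(w, w) = 0`, whence `w = 0` by positive definiteness (the composition-algebra
   identity `x² - ⟨x, 1⟩x + N(x) = 0`).
2. **On `T_ℓ E ≅ ℤ_ℓ²`:** `φ_ℓ² - tφ_ℓ + deg φ = 0`; by Cayley–Hamilton
   `φ_ℓ² - tr(φ_ℓ)φ_ℓ + det(φ_ℓ) = 0`, so `(tr φ_ℓ - t) φ_ℓ = det φ_ℓ - deg φ`: either
   `tr φ_ℓ = t` and `det φ_ℓ = deg φ`, or `φ_ℓ = c` is a scalar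
   (`exists_eq_smul_id_or_trace_eq_and_det_eq`).
3. **The scalar case `φ_ℓ = c ∈ ℤ_ℓ`** (`two_mul_eq_and_sq_eq_of_map_eq_smul_id`): `c` is a root
   of `g(X) = X² - tX + deg φ = (X - c)(X - c')`. For each `n` pick an integer `cₙ` with
   `|cₙ - c|_ℓ = ℓ^{-n}` acting like `c` on `E[ℓ^n]`; then `φ - cₙ` kills `E[ℓ^n]`, so it is `0`
   (and then `c = cₙ`, `deg φ = cₙ²`, `t = 2cₙ`) or an isogeny with `ℓ^{2n} = #E[ℓ^n] ∣
   #ker(φ - cₙ) ∣ deg(φ - cₙ) = g(cₙ) = (cₙ - c)(cₙ - c')` (Thm. III.4.10: `#ker ∣ deg`, the tree's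
   `Isogeny.card_ker_dvd_deg_holds`; `#E[ℓ^n] = ℓ^{2n}`, Cor. III.6.4(b), the tree's
   `card_torsionPoints_eq_sq_holds`), whence `|cₙ - c'|_ℓ ≤ ℓ^{-n}` and `|c - c'|_ℓ ≤ ℓ^{-n}`. So
   `c = c'`, `t = 2c = tr φ_ℓ`, `deg φ = c² = det φ_ℓ`.

## References

* [SilvermanAEC2009] J. H. Silverman, *The Arithmetic of Elliptic Curves*, 2nd ed., GTM 106,
  Springer 2009: II.§2 (pp. 20–21: `φ^*`, `deg φ = [K(C₁) : φ^* K(C₂)]`), III.§4 (p. 66),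
  Thm. III.4.10(a), III.§6 (proof of Thm. III.6.2; Cor. III.6.3; Cor. III.6.4(b)), Prop. III.8.6,
  Thm. V.2.3.1.
* D. Mumford, *Abelian Varieties*, 2nd ed., Oxford 1974, §19, Thm. 4 (`deg f = det T_ℓ(f)`).

## Design

`noncomputable section`, `open scoped Classical`, `K : Type u`, dot-notation extensions in
`namespace WeierstrassCurve(.Isogeny)`, as in the sibling files; nothing is defined (pure
`theorem`s, no notation). Mathlib has no maps of curves and no degree of such a map (see
`IsogenyDegree`); the field-theoretic tower law is Mathlib's (`Module.finrank`,
`IntermediateField.relfinrank`). In (B) the polar pairing is written out in every statement,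
`degHom W W (f + g) - degHom W W f - degHom W W g`, matching the printed form of the named fact
`degHom_isQuadraticForm`. The transfer of `f ∘ f - t f + d = 0` from `End(E(K̄))` to `End(T_ℓ E)` is
the one lemma `Literature.NumberTheory.EllipticCurves.TateModule.map_mul_map_sub_smul_add_smul_one_eq_zero` (proved componentwise);
the additivity lemmas `Literature.NumberTheory.EllipticCurves.TateModule.map_add` etc. of
`Literature.AlgebraicGeometry.Motives.FaltingsECTateLemma1Proofs` are not used (that file lies
above this one in the import graph).
-/

noncomputable section

open scoped Classical

universe u

/-! # (A) The degree of a composite isogeny -/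

namespace WeierstrassCurve

open geomPoints Literature.NumberTheory.EllipticCurves.WeierstrassFunctionField

variable {K : Type u} [Field K] {W W' W'' : WeierstrassCurve K}

namespace Isogeny

/-! ## `(ψ ∘ φ)^* = φ^* ∘ ψ^*` on the Weierstrass coordinates, and on `K̄(E'')` -/

section Comp

variable (ψ : Isogeny W' W'') (φ : Isogeny W W')

/-- The finite set of points to avoid when comparing `(ψ ∘ φ)^*` with `φ^* ∘ ψ^*`: the exceptional
sets of the rational representations of `ψ ∘ φ` and of `φ`, and the preimage under `φ` of that of
`ψ` (finite, the fibres of `φ` being finite). [folklore] -/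
theorem finite_badSet_comp :
    ({P : W.geomPoints | ¬ AgreesWithRationalMapAt W W'' (ψ.comp φ).rationalRep.P₁
        (ψ.comp φ).rationalRep.Q₁ (ψ.comp φ).rationalRep.P₂ (ψ.comp φ).rationalRep.Q₂ (ψ.comp φ) P} ∪
      {P : W.geomPoints | ¬ AgreesWithRationalMapAt W W' φ.rationalRep.P₁ φ.rationalRep.Q₁
        φ.rationalRep.P₂ φ.rationalRep.Q₂ φ P} ∪
      (φ ⁻¹' {Q : W'.geomPoints | ¬ AgreesWithRationalMapAt W' W'' ψ.rationalRep.P₁ ψ.rationalRep.Q₁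
        ψ.rationalRep.P₂ ψ.rationalRep.Q₂ ψ Q})).Finite :=
  ((ψ.comp φ).rationalRep.finite.union φ.rationalRep.finite).union
    (ψ.rationalRep.finite.preimage' fun Q _ ↦ φ.finite_fibre Q)

variable [W.IsElliptic]

/-- **`(ψ ∘ φ)^* x'' = φ^* (ψ^* x'')`**: both have the value `x''(ψ (φ P))` at all but finitely
many `P`. Silverman, *AEC*, II.§2 (`(ψ ∘ φ)^* = φ^* ∘ ψ^*`). [folklore] -/
theorem pullbackX_comp : (ψ.comp φ).pullbackX = φ.pullbackHom ψ.pullbackX := by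
  apply eq_of_infinite_setOf_hasValueAt
  refine (finite_badSet_comp ψ φ).infinite_compl.mono ?_
  intro P hP
  simp only [Set.mem_compl_iff, Set.mem_union, Set.mem_setOf_eq, Set.mem_preimage, not_or,
    not_not] at hP
  obtain ⟨⟨hP1, hP2⟩, hP3⟩ := hP
  have hP0 : P ≠ 0 := (agreesWithRationalMapAt_iff.mp hP1).1
  have hv1 : W.HasValueAt (ψ.comp φ).pullbackX P (xy (ψ (φ P)) 0) := by
    simpa using (ψ.comp φ).hasValueAt_pullback_gen hP1 0
  have hv3 : W.HasValueAt (φ.pullbackHom ψ.pullbackX) P (xy (ψ (φ P)) 0) :=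
    HasValueAt.pullbackHom φ hP2 (by simpa using ψ.hasValueAt_pullback_gen hP3 0)
  exact ⟨hP0, _, hv1, hv3⟩

/-- **`(ψ ∘ φ)^* y'' = φ^* (ψ^* y'')`.** Silverman, *AEC*, II.§2. [folklore] -/
theorem pullbackY_comp : (ψ.comp φ).pullbackY = φ.pullbackHom ψ.pullbackY := by
  apply eq_of_infinite_setOf_hasValueAt
  refine (finite_badSet_comp ψ φ).infinite_compl.mono ?_
  intro P hP
  simp only [Set.mem_compl_iff, Set.mem_union, Set.mem_setOf_eq, Set.mem_preimage, not_or,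
    not_not] at hP
  obtain ⟨⟨hP1, hP2⟩, hP3⟩ := hP
  have hP0 : P ≠ 0 := (agreesWithRationalMapAt_iff.mp hP1).1
  have hv1 : W.HasValueAt (ψ.comp φ).pullbackY P (xy (ψ (φ P)) 1) := by
    simpa using (ψ.comp φ).hasValueAt_pullback_gen hP1 1
  have hv3 : W.HasValueAt (φ.pullbackHom ψ.pullbackY) P (xy (ψ (φ P)) 1) :=
    HasValueAt.pullbackHom φ hP2 (by simpa using ψ.hasValueAt_pullback_gen hP3 1)
  exact ⟨hP0, _, hv1, hv3⟩

variable [W'.IsElliptic] in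
/-- **`(ψ ∘ φ)^* = φ^* ∘ ψ^*` on `K̄(E'')`** (a `K̄`-algebra map out of `K̄(E'') = K̄(x'', y'')` is
determined by the images of `x'', y''`). Silverman, *AEC*, II.§2. [folklore] -/
theorem pullbackHom_comp : (ψ.comp φ).pullbackHom = φ.pullbackHom.comp ψ.pullbackHom :=
  algHom_ext_xy (by rw [AlgHom.comp_apply, pullbackHom_genX, pullbackHom_genX, pullbackX_comp])
    (by rw [AlgHom.comp_apply, pullbackHom_genY, pullbackHom_genY, pullbackY_comp])

/-- **`(ψ ∘ φ)^* K̄(E'') = φ^*(ψ^* K̄(E''))`** as subfields of `K̄(E)`. Silverman, *AEC*, II.§2.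
[folklore] -/
theorem pullbackField_comp :
    (ψ.comp φ).pullbackField = ψ.pullbackField.map φ.pullbackHom := by
  rw [Isogeny.pullbackField, Isogeny.pullbackField, IntermediateField.adjoin_map, Set.image_pair,
    pullbackX_comp, pullbackY_comp]

/-- **The tower law `deg (ψ ∘ φ) = deg ψ · deg φ`**:
`[K̄(E) : φ^* ψ^* K̄(E'')] = [K̄(E) : φ^* K̄(E')] · [φ^* K̄(E') : φ^* ψ^* K̄(E'')]` and
`[φ^* K̄(E') : φ^* ψ^* K̄(E'')] = [K̄(E') : ψ^* K̄(E'')]`, `φ^*` being a field isomorphism onto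
`φ^* K̄(E')`. Silverman, *AEC*, II.§2 (p. 21) and III.§6 (proof of Thm. III.6.2(a),(e)).
[cite: SilvermanAEC2009, II.§2 (degree of a map) and Thm. III.6.2 (proof)] -/
theorem deg_comp : (ψ.comp φ).deg = ψ.deg * φ.deg := by
  set f := φ.pullbackHom with hf
  have hrange : f.fieldRange = φ.pullbackField := φ.fieldRange_pullbackHom
  have hle : ψ.pullbackField.map f ≤ (⊤ : IntermediateField _ W'.geomFunctionField).map f :=
    IntermediateField.map_mono f le_top
  have htop : (⊤ : IntermediateField _ W'.geomFunctionField).map f = φ.pullbackField := by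
    rw [← AlgHom.fieldRange_eq_map, hrange]
  have h1 := IntermediateField.relfinrank_mul_finrank_top hle
  rw [IntermediateField.relfinrank_map_map, IntermediateField.relfinrank_top_right, htop] at h1
  rw [Isogeny.deg, Isogeny.deg, Isogeny.deg, pullbackField_comp, ← h1]

end Comp

/-! ## `deg [1] = 1` -/

section Id

variable (W)

/-- `[1] ∘ [1] = [1]`. [folklore] -/
theorem id_comp_id : (Isogeny.id W).comp (Isogeny.id W) = Isogeny.id W :=
  Isogeny.ext fun _ ↦ rfl

variable [W.IsElliptic]

/-- **`deg [1] = 1`** (`deg [1] = deg ([1] ∘ [1]) = (deg [1])²` and `deg [1] ≥ 1`). Silverman,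
*AEC*, III.§4 (`[1]` is an isomorphism), Thm. III.6.2(d) (`deg [m] = m²`) at `m = 1`. [folklore] -/
theorem deg_id : (Isogeny.id W).deg = 1 := by
  have h := deg_comp (Isogeny.id W) (Isogeny.id W)
  rw [id_comp_id] at h
  have hpos : 0 < (Isogeny.id W).deg := deg_pos_holds _
  -- `d = d * d` with `d > 0` forces `d = 1`
  have : (Isogeny.id W).deg * 1 = (Isogeny.id W).deg * (Isogeny.id W).deg
        := by rw [mul_one]; exact h
  exact (Nat.eq_of_mul_eq_mul_left hpos this).symm

end Id

end Isogeny

/-! ## Multiplicativity of `degHom` on `Hom_K` -/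

section DegHom

variable [W.IsElliptic] [W'.IsElliptic] [W''.IsElliptic]

/-- **`deg (f ∘ g) = deg f · deg g` on `Hom_K`** (with `deg 0 = 0`): the tower law `deg_comp` on
isogenies, the cases with a zero factor being `0 = 0` (`Hom_K = {0} ∪ {isogenies}`,
`mem_homModule_iff_holds`). Silverman, *AEC*, II.§2, III.§4, III.§6. [folklore] -/
theorem degHom_comp {f : W'.geomPoints →+ W''.geomPoints} {g : W.geomPoints →+ W'.geomPoints}
    (hf : f ∈ homModule W' W'') (hg : g ∈ homModule W W') :
    degHom W W'' (f.comp g) = degHom W' W'' f * degHom W W' g := by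
  rcases (mem_homModule_iff_holds W' W'' f).mp hf with rfl | ⟨ψ, rfl⟩
  · rw [AddMonoidHom.zero_comp, degHom_zero, degHom_zero, zero_mul]
  rcases (mem_homModule_iff_holds W W' g).mp hg with rfl | ⟨φ, rfl⟩
  · rw [AddMonoidHom.comp_zero, degHom_zero, degHom_zero, mul_zero]
  rw [show ψ.toAddMonoidHom.comp φ.toAddMonoidHom = (ψ.comp φ).toAddMonoidHom from rfl,
    degHom_toAddMonoidHom, degHom_toAddMonoidHom, degHom_toAddMonoidHom, Isogeny.deg_comp,
    Nat.cast_mul]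

variable (W) in
/-- **`deg [1] = 1` for `degHom`.** [folklore] -/
theorem degHom_id : degHom W W (AddMonoidHom.id _) = 1 := by
  rw [show AddMonoidHom.id W.geomPoints = (Isogeny.id W).toAddMonoidHom from rfl,
    degHom_toAddMonoidHom, Isogeny.deg_id, Nat.cast_one]

variable (W) in
omit [W.IsElliptic] [W'.IsElliptic] [W''.IsElliptic] in
/-- `[1] ∈ Hom_K(E, E)`. [folklore] -/
theorem id_mem_homModule : AddMonoidHom.id W.geomPoints ∈ homModule W W :=
  (Isogeny.id W).toAddMonoidHom_mem_homModule

/-- `Hom_K` is closed under composition: `f ∘ g ∈ Hom_K(E, E'')` for `f ∈ Hom_K(E', E'')`,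
`g ∈ Hom_K(E, E')`. Silverman, *AEC*, III.§4 ("isogenies are closed under composition").
[folklore] -/
theorem comp_mem_homModule {f : W'.geomPoints →+ W''.geomPoints} {g : W.geomPoints →+ W'.geomPoints}
    (hf : f ∈ homModule W' W'') (hg : g ∈ homModule W W') : f.comp g ∈ homModule W W'' := by
  rcases (mem_homModule_iff_holds W' W'' f).mp hf with rfl | ⟨ψ, rfl⟩
  · rw [AddMonoidHom.zero_comp]; exact Submodule.zero_mem _
  rcases (mem_homModule_iff_holds W W' g).mp hg with rfl | ⟨φ, rfl⟩
  · rw [AddMonoidHom.comp_zero]; exact Submodule.zero_mem _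
  exact (ψ.comp φ).toAddMonoidHom_mem_homModule

end DegHom

end WeierstrassCurve

/-! # (B) `det(φ_ℓ) = deg φ` from Cor. III.6.3 -/


/-! ## Transfer of a quadratic relation in `End(A)` to the Tate module -/

namespace Literature.NumberTheory.EllipticCurves.TateModule

/-- **`T_p` turns `f ∘ f - t f + d = 0` in `End(A)` into `T_p(f)² - t T_p(f) + d = 0` in
`End_{ℤ_p}(T_p A)`** (componentwise: `(T_p f a)_n = f(a_n)`). [folklore] -/
theorem map_mul_map_sub_smul_add_smul_one_eq_zero {A : Type u} [AddCommGroup A] (p : ℕ) [Fact p.Prime]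
    {f : A →+ A} {t d : ℤ} (h : f.comp f - t • f + d • AddMonoidHom.id A = 0) :
    map p f * map p f - (t : ℤ_[p]) • map p f + (d : ℤ_[p]) • (1 : TateModule A p →ₗ[ℤ_[p]] _)
          = 0 := by
  refine LinearMap.ext fun a ↦ TateModule.ext fun n ↦ ?_
  have h1 : f (f (proj p n a)) - t • f (proj p n a) + d • proj p n a = 0 :=
    congrArg (fun g : A →+ A ↦ g (proj p n a)) h
  simp only [LinearMap.add_apply, LinearMap.sub_apply, LinearMap.smul_apply, Module.End.mul_apply,
    Module.End.one_apply, LinearMap.zero_apply]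
  rw [Int.cast_smul_eq_zsmul, Int.cast_smul_eq_zsmul, _root_.map_add, _root_.map_sub,
    _root_.map_zsmul, _root_.map_zsmul, proj_map, proj_map, _root_.map_zero]
  exact h1

end Literature.NumberTheory.EllipticCurves.TateModule

namespace WeierstrassCurve

open Literature.NumberTheory.EllipticCurves

variable {K : Type u} [Field K] {W : WeierstrassCurve K}

/-! ## The quadratic form `deg` on `End_K(E)` is compatible with composition: `φ² - tφ + deg φ = 0` -/

section QuadraticForm

variable [W.IsElliptic] (h63 : degHom_isQuadraticForm W W)
include h63

/-- `deg(-f) = deg f` (Cor. III.6.3(i)). [cite: SilvermanAEC2009, Cor. III.6.3] -/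
theorem degHom_neg {f : W.geomPoints →+ W.geomPoints} (hf : f ∈ homModule W W) :
    degHom W W (-f) = degHom W W f :=
  (@h63 _ _).1 f hf

/-- Additivity of the polar pairing `B(f, g) = deg(f + g) - deg f - deg g` in the first variable
(Cor. III.6.3(ii)). [cite: SilvermanAEC2009, Cor. III.6.3] -/
theorem degPairing_add_left {f g h : W.geomPoints →+ W.geomPoints} (hf : f ∈ homModule W W)
    (hg : g ∈ homModule W W) (hh : h ∈ homModule W W) :
    degHom W W (f + g + h) - degHom W W (f + g) - degHom W W h =
      (degHom W W (f + h) - degHom W W f - degHom W W h) +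
        (degHom W W (g + h) - degHom W W g - degHom W W h) :=
  (@h63 _ _).2 f hf g hg h hh

omit [W.IsElliptic] h63 in
/-- The polar pairing is symmetric. [folklore] -/
theorem degPairing_comm (f g : W.geomPoints →+ W.geomPoints) :
    degHom W W (f + g) - degHom W W f - degHom W W g =
      degHom W W (g + f) - degHom W W g - degHom W W f := by
  rw [add_comm]; ring

omit h63 in
/-- `B(0, g) = 0` (`deg 0 = 0`). [folklore] -/
theorem degPairing_zero_left (g : W.geomPoints →+ W.geomPoints) :
    degHom W W (0 + g) - degHom W W 0 - degHom W W g = 0 := by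
  rw [zero_add, degHom_zero]; ring

/-- Additivity of the polar pairing in the second variable. [folklore] -/
theorem degPairing_add_right {f g h : W.geomPoints →+ W.geomPoints} (hf : f ∈ homModule W W)
    (hg : g ∈ homModule W W) (hh : h ∈ homModule W W) :
    degHom W W (f + (g + h)) - degHom W W f - degHom W W (g + h) =
      (degHom W W (f + g) - degHom W W f - degHom W W g) +
        (degHom W W (f + h) - degHom W W f - degHom W W h) := by
  rw [degPairing_comm, degPairing_add_left h63 hg hh hf, degPairing_comm g, degPairing_comm h]

/-- `B(-f, g) = -B(f, g)`. [folklore] -/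
theorem degPairing_neg_left {f g : W.geomPoints →+ W.geomPoints} (hf : f ∈ homModule W W)
    (hg : g ∈ homModule W W) :
    degHom W W (-f + g) - degHom W W (-f) - degHom W W g =
      -(degHom W W (f + g) - degHom W W f - degHom W W g) := by
  have h := degPairing_add_left h63 hf (neg_mem hf) hg
  rw [add_neg_cancel, degPairing_zero_left] at h
  linarith

/-- `B(n • f, g) = n B(f, g)` for `n : ℕ`. [folklore] -/
theorem degPairing_nsmul_left {f g : W.geomPoints →+ W.geomPoints} (hf : f ∈ homModule W W)
    (hg : g ∈ homModule W W) (n : ℕ) :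
    degHom W W (n • f + g) - degHom W W (n • f) - degHom W W g =
      n * (degHom W W (f + g) - degHom W W f - degHom W W g) := by
  induction n with
  | zero => rw [zero_nsmul, degPairing_zero_left, Nat.cast_zero, zero_mul]
  | succ n ih =>
    rw [succ_nsmul, degPairing_add_left h63 (nsmul_mem hf n) hf hg, ih, Nat.cast_succ]
    ring

/-- `B(m • f, g) = m B(f, g)` for `m : ℤ`. [folklore] -/
theorem degPairing_zsmul_left {f g : W.geomPoints →+ W.geomPoints} (hf : f ∈ homModule W W)
    (hg : g ∈ homModule W W) (m : ℤ) :
    degHom W W (m • f + g) - degHom W W (m • f) - degHom W W g =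
      m * (degHom W W (f + g) - degHom W W f - degHom W W g) := by
  obtain ⟨n, rfl | rfl⟩ := Int.eq_nat_or_neg m
  · rw [natCast_zsmul, degPairing_nsmul_left h63 hf hg]
  · rw [neg_smul, natCast_zsmul, degPairing_neg_left h63 (nsmul_mem hf n) hg,
      degPairing_nsmul_left h63 hf hg]
    ring

/-- `B(f, m • g) = m B(f, g)` for `m : ℤ`. [folklore] -/
theorem degPairing_zsmul_right {f g : W.geomPoints →+ W.geomPoints} (hf : f ∈ homModule W W)
    (hg : g ∈ homModule W W) (m : ℤ) :
    degHom W W (f + m • g) - degHom W W f - degHom W W (m • g) =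
      m * (degHom W W (f + g) - degHom W W f - degHom W W g) := by
  rw [degPairing_comm, degPairing_zsmul_left h63 hg hf, degPairing_comm]

/-- `B(f, f) = 2 deg f` (the parallelogram law at `g = f`). [folklore] -/
theorem degPairing_self {f : W.geomPoints →+ W.geomPoints} (hf : f ∈ homModule W W) :
    degHom W W (f + f) - degHom W W f - degHom W W f = 2 * degHom W W f := by
  have h := degHom_parallelogram h63 hf hf
  rw [sub_self, degHom_zero] at h
  linarith

/-- `deg(m • f) = m² deg f`. Silverman, *AEC*, Cor. III.6.3 (a quadratic form). [folklore] -/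
theorem degHom_zsmul {f : W.geomPoints →+ W.geomPoints} (hf : f ∈ homModule W W) (m : ℤ) :
    degHom W W (m • f) = m ^ 2 * degHom W W f := by
  suffices hn : ∀ n : ℕ, degHom W W (n • f) = (n : ℤ) ^ 2 * degHom W W f by
    obtain ⟨n, rfl | rfl⟩ := Int.eq_nat_or_neg m
    · rw [natCast_zsmul, hn]
    · rw [neg_smul, natCast_zsmul, degHom_neg h63 (nsmul_mem hf n), hn]
      ring
  intro n
  induction n with
  | zero => rw [zero_nsmul, degHom_zero, Nat.cast_zero]; ring
  | succ n ih =>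
    have h := degPairing_nsmul_left h63 hf hf n
    rw [degPairing_self h63 hf] at h
    -- `deg(n f + f) = deg(n f) + deg f + B(n f, f)`
    have h' : degHom W W (n • f + f) =
        degHom W W (n • f) + degHom W W f + n * (2 * degHom W W f) := by
      linarith
    rw [succ_nsmul, h', ih, Nat.cast_succ]
    ring

/-- `deg(f + m • g) = deg f + m B(f, g) + m² deg g`. [folklore] -/
theorem degHom_add_zsmul {f g : W.geomPoints →+ W.geomPoints} (hf : f ∈ homModule W W)
    (hg : g ∈ homModule W W) (m : ℤ) :
    degHom W W (f + m • g) =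
      degHom W W f + m * (degHom W W (f + g) - degHom W W f - degHom W W g) +
        m ^ 2 * degHom W W g := by
  have h := degPairing_zsmul_right h63 hf hg m
  rw [degHom_zsmul h63 hg] at h
  linarith

omit h63 in
/-- **First linearisation of `deg(f ∘ g) = deg f · deg g`: `B(f ∘ g, f ∘ h) = deg f · B(g, h)`.**
[folklore] -/
theorem degPairing_comp_left {f g h : W.geomPoints →+ W.geomPoints} (hf : f ∈ homModule W W)
    (hg : g ∈ homModule W W) (hh : h ∈ homModule W W) :
    degHom W W (f.comp g + f.comp h) - degHom W W (f.comp g) - degHom W W (f.comp h) =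
      degHom W W f * (degHom W W (g + h) - degHom W W g - degHom W W h) := by
  have h1 := degHom_comp hf (add_mem hg hh)
  rw [AddMonoidHom.comp_add] at h1
  rw [h1, degHom_comp hf hg, degHom_comp hf hh]
  ring

/-- **Second linearisation: `B(f ∘ g, k ∘ h) + B(k ∘ g, f ∘ h) = B(f, k) · B(g, h)`.** [folklore] -/
theorem degPairing_comp_add_degPairing_comp {f k g h : W.geomPoints →+ W.geomPoints}
    (hf : f ∈ homModule W W) (hk : k ∈ homModule W W) (hg : g ∈ homModule W W)
    (hh : h ∈ homModule W W) :
    (degHom W W (f.comp g + k.comp h) - degHom W W (f.comp g) - degHom W W (k.comp h)) +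
        (degHom W W (k.comp g + f.comp h) - degHom W W (k.comp g) - degHom W W (f.comp h)) =
      (degHom W W (f + k) - degHom W W f - degHom W W k) *
        (degHom W W (g + h) - degHom W W g - degHom W W h) := by
  have h1 := degPairing_comp_left (add_mem hf hk) hg hh
  rw [AddMonoidHom.add_comp, AddMonoidHom.add_comp,
    degPairing_add_left h63 (comp_mem_homModule hf hg) (comp_mem_homModule hk hg)
      (add_mem (comp_mem_homModule hf hh) (comp_mem_homModule hk hh)),
    degPairing_add_right h63 (comp_mem_homModule hf hg) (comp_mem_homModule hf hh)
      (comp_mem_homModule hk hh),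
    degPairing_add_right h63 (comp_mem_homModule hk hg) (comp_mem_homModule hf hh)
      (comp_mem_homModule hk hh),
    degPairing_comp_left hf hg hh, degPairing_comp_left hk hg hh] at h1
  linarith

/-- **`B(w, h) = 0` for every `h ∈ End_K(E)`, where `w = f ∘ f - B(f, 1) f + (deg f) 1`** (the
second linearisation at `k = 1`, `g = f`, and the first at `g = 1`). [folklore] -/
theorem degPairing_comp_self_sub_eq_zero {f h : W.geomPoints →+ W.geomPoints}
    (hf : f ∈ homModule W W) (hh : h ∈ homModule W W) :
    let t : ℤ := degHom W W (f + AddMonoidHom.id W.geomPoints) - degHom W W f -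
      degHom W W (AddMonoidHom.id W.geomPoints)
    let w := f.comp f - t • f + degHom W W f • AddMonoidHom.id W.geomPoints
    degHom W W (w + h) - degHom W W w - degHom W W h = 0 := by
  intro t w
  have h1 := degPairing_comp_add_degPairing_comp h63 hf (id_mem_homModule W) hf hh
  have h2 := degPairing_comp_left hf (id_mem_homModule W) hh
  rw [AddMonoidHom.id_comp, AddMonoidHom.id_comp] at h1
  rw [AddMonoidHom.comp_id] at h2
  have hff : f.comp f ∈ homModule W W := comp_mem_homModule hf hf
  have h1m : t • f ∈ homModule W W := Submodule.smul_mem _ _ hf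
  have h2m : degHom W W f • AddMonoidHom.id W.geomPoints ∈ homModule W W :=
    Submodule.smul_mem _ _ (id_mem_homModule W)
  show degHom W W (f.comp f - t • f + degHom W W f • AddMonoidHom.id W.geomPoints + h) -
      degHom W W (f.comp f - t • f + degHom W W f • AddMonoidHom.id W.geomPoints) -
      degHom W W h = 0
  rw [sub_eq_add_neg (f.comp f), degPairing_add_left h63 (add_mem hff (neg_mem h1m)) h2m hh,
    degPairing_add_left h63 hff (neg_mem h1m) hh, degPairing_neg_left h63 h1m hh,
    degPairing_zsmul_left h63 hf hh, degPairing_zsmul_left h63 (id_mem_homModule W) hh]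
  show _ - t * _ + _ = 0
  linarith

/-- **The composition-algebra identity in `End_K(E)`: `f ∘ f - t • f + (deg f) • 1 = 0` with
`t = deg(f + 1) - deg f - 1`**, for every `f ∈ End_K(E)` (`Hom_K(E, E)` with `deg 0 = 0`), from
Cor. III.6.3 (`h63`) and the multiplicativity of `deg`: `w = f² - B(f, 1) f + deg f` is orthogonal
to all of `End_K(E)`, in particular `2 deg w = B(w, w) = 0`, so `w = 0` by positive definiteness
(`degHom_pos_holds`). For the Frobenius `φ` of a curve over `𝔽_q` this is `φ² - aφ + q = 0`,
Silverman, *AEC*, Thm. V.2.3.1(b) (there deduced from III.8.6).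
[cite: SilvermanAEC2009, Cor. III.6.3 and Thm. V.2.3.1(b)] -/
theorem comp_self_sub_smul_add_smul_id_eq_zero {f : W.geomPoints →+ W.geomPoints}
    (hf : f ∈ homModule W W) :
    f.comp f - (degHom W W (f + AddMonoidHom.id W.geomPoints) - degHom W W f - 1) • f +
      degHom W W f • AddMonoidHom.id W.geomPoints = 0 := by
  rw [← degHom_id W]
  set w := f.comp f - (degHom W W (f + AddMonoidHom.id W.geomPoints) - degHom W W f -
    degHom W W (AddMonoidHom.id W.geomPoints)) • f + degHom W W f • AddMonoidHom.id W.geomPoints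
    with hw
  have hwm : w ∈ homModule W W :=
    add_mem (sub_mem (comp_mem_homModule hf hf) (Submodule.smul_mem _ _ hf))
      (Submodule.smul_mem _ _ (id_mem_homModule W))
  have h0 : degHom W W (w + w) - degHom W W w - degHom W W w = 0 :=
    degPairing_comp_self_sub_eq_zero h63 hf hwm
  rw [degPairing_self h63 hwm] at h0
  by_contra hne
  have hpos := degHom_pos_holds hwm hne
  linarith

end QuadraticForm

/-! ## Linear algebra on `T_ℓ E ≅ ℤ_ℓ²` -/

section LinearAlgebra

variable (W) (ℓ : ℕ) [Fact ℓ.Prime]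

/-- **Cayley–Hamilton on `T_ℓ E`**: `M² - tr(M) M + det(M) = 0` for an endomorphism `M` of the free
rank-`2` `ℤ_ℓ`-module `T_ℓ E` (`ℓ ≠ char K`). [folklore] -/
theorem tateModule_map_sq_sub_trace_smul_add_det_smul [W.IsElliptic] (hℓ : (ℓ : K) ≠ 0)
    (M : W.tateModule ℓ →ₗ[ℤ_[ℓ]] W.tateModule ℓ) :
    M * M - LinearMap.trace ℤ_[ℓ] _ M • M + LinearMap.det M • (1 : W.tateModule ℓ →ₗ[ℤ_[ℓ]] _)
          = 0 := by
  haveI := module_free_tateModule_holds W ℓ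
  haveI := module_finite_tateModule_holds W ℓ
  have h := LinearMap.aeval_self_charpoly M
  rw [charpoly_tateModule_eq hℓ M] at h
  simpa [sq, Algebra.smul_def, sub_eq_add_neg, add_assoc] using h

/-- **Either `M` is a scalar, or its trace and determinant are read off from any monic quadratic
relation**: if `M² - tM + d = 0` on `T_ℓ E ≅ ℤ_ℓ²`, then `M = c · 1` for some `c ∈ ℤ_ℓ`, or
`tr M = t` and `det M = d` (subtract Cayley–Hamilton: `(tr M - t) M = (det M - d) · 1`). [folklore] -/
theorem exists_eq_smul_id_or_trace_eq_and_det_eq [W.IsElliptic] (hℓ : (ℓ : K) ≠ 0)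
    (M : W.tateModule ℓ →ₗ[ℤ_[ℓ]] W.tateModule ℓ) {t d : ℤ_[ℓ]}
    (h : M * M - t • M + d • (1 : W.tateModule ℓ →ₗ[ℤ_[ℓ]] _) = 0) :
    (∃ c : ℤ_[ℓ], M = c • LinearMap.id) ∨
      (LinearMap.trace ℤ_[ℓ] _ M = t ∧ LinearMap.det M = d) := by
  haveI := module_free_tateModule_holds W ℓ
  haveI := module_finite_tateModule_holds W ℓ
  set τ := LinearMap.trace ℤ_[ℓ] _ M
  set δ := LinearMap.det M
  have hCH := tateModule_map_sq_sub_trace_smul_add_det_smul W ℓ hℓ M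
  -- `(τ - t) • M = (δ - d) • 1`
  have hrel : (τ - t) • M = (δ - d) • (1 : W.tateModule ℓ →ₗ[ℤ_[ℓ]] _) := by
    have : (M * M - t • M + d • 1) - (M * M - τ • M + δ • 1) = 0 := by rw [h, hCH, sub_zero]
    rw [sub_smul, sub_smul]
    rw [← sub_eq_zero]
    rw [← this]
    abel
  let b := Module.finBasisOfFinrankEq ℤ_[ℓ] (W.tateModule ℓ) (finrank_tateModule_eq_two_holds W ℓ hℓ)
  by_cases hs : τ - t = 0
  · right
    rw [hs, zero_smul] at hrel
    have hδ : δ - d = 0 := by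
      have h1 := congrArg (fun f : W.tateModule ℓ →ₗ[ℤ_[ℓ]] W.tateModule ℓ ↦ f (b 0)) hrel
      simp only [LinearMap.zero_apply, LinearMap.smul_apply, Module.End.one_apply] at h1
      exact (smul_eq_zero.mp h1.symm).resolve_right (b.ne_zero 0)
    exact ⟨(sub_eq_zero.mp hs).symm ▸ rfl, by rw [← sub_eq_zero]; exact hδ⟩
  · left
    -- the scalar is the `(0,0)` coordinate of `M (b 0)`
    set c := b.repr (M (b 0)) 0 with hc
    refine ⟨c, ?_⟩
    have h1 := congrArg (fun f : W.tateModule ℓ →ₗ[ℤ_[ℓ]] W.tateModule ℓ ↦ b.repr (f (b 0)) 0) hrel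
    simp only [LinearMap.smul_apply, Module.End.one_apply, map_smul, Finsupp.smul_apply,
      smul_eq_mul, Module.Basis.repr_self, Finsupp.single_eq_same, mul_one] at h1
    -- `h1 : (τ - t) * c = δ - d`
    have h2 : (τ - t) • (M - c • LinearMap.id) = 0 := by
      rw [smul_sub, hrel, ← h1, ← hc, mul_smul]
      exact sub_self _
    have h3 : M - c • LinearMap.id = 0 := by
      refine LinearMap.ext fun x ↦ ?_
      have hx := congrArg (fun f : W.tateModule ℓ →ₗ[ℤ_[ℓ]] W.tateModule ℓ ↦ f x) h2
      simp only [LinearMap.smul_apply, LinearMap.zero_apply] at hx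
      exact (smul_eq_zero.mp hx).resolve_left hs
    exact sub_eq_zero.mp h3

end LinearAlgebra

/-! ## The scalar case: `φ_ℓ = c` forces `t = 2c`, `deg φ = c²` -/

section Scalar

variable [W.IsElliptic] {ℓ : ℕ} [Fact ℓ.Prime]

omit [W.IsElliptic] in
/-- For `c ∈ ℤ_ℓ` and `n`, an integer `cₙ` with `|cₙ - c|_ℓ = ℓ^{-n}` acting like `c` on `E[ℓ^n]`:
`cₙ = a + ℓ^n` where `a = c mod ℓ^{n+1}`. [folklore] -/
theorem exists_int_norm_sub_eq (c : ℤ_[ℓ]) (n : ℕ) :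
    ∃ m : ℤ, ‖(m : ℤ_[ℓ]) - c‖ = (ℓ : ℝ) ^ (-(n : ℤ)) ∧
      ∀ P ∈ geomTorsion W (ℓ ^ n : ℕ), m • P = (PadicInt.toZModPow n c).val • P := by
  have hℓ1 : (1 : ℝ) < ℓ := by exact_mod_cast (Fact.out : ℓ.Prime).one_lt
  set a : ℕ := (PadicInt.toZModPow (n + 1) c).val with ha
  -- `c - a ∈ (ℓ^{n+1})`
  have hca : ‖(a : ℤ_[ℓ]) - c‖ ≤ (ℓ : ℝ) ^ (-((n + 1 : ℕ) : ℤ)) := by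
    rw [← norm_neg, neg_sub, PadicInt.norm_le_pow_iff_mem_span_pow, ← PadicInt.ker_toZModPow,
      RingHom.mem_ker, map_sub, map_natCast, ha, ZMod.natCast_zmod_val, sub_self]
  refine ⟨((a + ℓ ^ n : ℕ) : ℤ), ?_, fun P hP ↦ ?_⟩
  · have hpow : ‖((ℓ : ℤ_[ℓ]) ^ n)‖ = (ℓ : ℝ) ^ (-(n : ℤ)) := PadicInt.norm_p_pow n
    have hlt : ‖(a : ℤ_[ℓ]) - c‖ < ‖((ℓ : ℤ_[ℓ]) ^ n)‖ := by
      rw [hpow]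
      refine hca.trans_lt ?_
      exact zpow_lt_zpow_right₀ hℓ1 (by push_cast; omega)
    have : (((a + ℓ ^ n : ℕ) : ℤ) : ℤ_[ℓ]) - c = ((a : ℤ_[ℓ]) - c) + (ℓ : ℤ_[ℓ]) ^ n := by
      push_cast; ring
    rw [this, PadicInt.norm_add_eq_max_of_ne hlt.ne, max_eq_right hlt.le, hpow]
  · -- on `E[ℓ^n]`: `(a + ℓ^n) P = (a mod ℓ^n) P = (c mod ℓ^n) P`
    rw [natCast_zsmul, AddSubgroup.torsionBy.mod_self_nsmul' _ hP, Nat.add_mod_right,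
      TateModule.val_toZModPow_eq_mod ℓ n c]

variable (h63 : degHom_isQuadraticForm W W)
include h63

/-- **The scalar case.** If `φ_ℓ = T_ℓ(φ) = c · 1` for an isogeny `φ ∈ End_K(E)` and `ℓ ≠ char K`,
then `t = 2c` and `deg φ = c²` in `ℤ_ℓ`, where `t = deg(φ + 1) - deg φ - 1`; in particular
`tr(φ_ℓ) = t` and `det(φ_ℓ) = deg φ`. Proof: step 3 of the module docstring (`ℓ^{2n} ∣ deg(φ - cₙ)`
for integers `cₙ → c`, forcing the two roots of `X² - tX + deg φ` to coincide).
[cite: SilvermanAEC2009, Prop. III.8.6 (statement); Cor. III.6.3, Cor. III.6.4(b), Thm. III.4.10(a) (inputs)] -/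
theorem two_mul_eq_and_sq_eq_of_map_eq_smul_id (hℓ : (ℓ : K) ≠ 0) (φ : Isogeny W W) {c : ℤ_[ℓ]}
    (hc : TateModule.map ℓ φ.toAddMonoidHom = c • LinearMap.id) :
    2 * c = ((degHom W W (φ.toAddMonoidHom + AddMonoidHom.id W.geomPoints)
          - degHom W W φ.toAddMonoidHom - 1 : ℤ) : ℤ_[ℓ]) ∧
      c ^ 2 = (φ.deg : ℤ_[ℓ]) := by
  haveI := module_free_tateModule_holds W ℓ
  haveI := module_finite_tateModule_holds W ℓ
  have hℓ1 : (1 : ℝ) < ℓ := by exact_mod_cast (Fact.out : ℓ.Prime).one_lt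
  have hfm : φ.toAddMonoidHom ∈ homModule W W := φ.toAddMonoidHom_mem_homModule
  -- the quadratic relation, in `End_K(E)` and on `T_ℓ E`
  have hrel := comp_self_sub_smul_add_smul_id_eq_zero h63 hfm
  have hrelT : c ^ 2 - ((degHom W W (φ.toAddMonoidHom + AddMonoidHom.id W.geomPoints)
        - degHom W W φ.toAddMonoidHom - 1 :
      ℤ) : ℤ_[ℓ]) * c + ((degHom W W φ.toAddMonoidHom : ℤ) : ℤ_[ℓ]) = 0 := by
    have h1 := TateModule.map_mul_map_sub_smul_add_smul_one_eq_zero ℓ hrel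
    rw [hc] at h1
    let b := Module.finBasisOfFinrankEq ℤ_[ℓ] (W.tateModule ℓ) (finrank_tateModule_eq_two_holds W ℓ hℓ)
    have h2 := congrArg (fun g : W.tateModule ℓ →ₗ[ℤ_[ℓ]] W.tateModule ℓ ↦ b.repr (g (b 0)) 0) h1
    simp only [LinearMap.add_apply, LinearMap.sub_apply, Module.End.mul_apply, LinearMap.smul_apply,
      LinearMap.id_apply, Module.End.one_apply, map_smul, map_add, map_sub, Finsupp.smul_apply,
      Finsupp.add_apply, Finsupp.sub_apply, smul_eq_mul, Module.Basis.repr_self,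
      Finsupp.single_eq_same, mul_one, LinearMap.zero_apply, map_zero, Finsupp.coe_zero,
      Pi.zero_apply] at h2
    linear_combination h2
  set f := φ.toAddMonoidHom with hf
  set t : ℤ := degHom W W (f + AddMonoidHom.id W.geomPoints) - degHom W W f - 1 with ht
  set d : ℤ := degHom W W f with hd
  have hdφ : d = φ.deg := degHom_toAddMonoidHom φ
  -- the other root `c' = t - c`
  set c' : ℤ_[ℓ] := (t : ℤ_[ℓ]) - c with hc'
  have hg : ∀ m : ℤ, ((d - m * t + m ^ 2 : ℤ) : ℤ_[ℓ]) = ((m : ℤ_[ℓ]) - c) * ((m : ℤ_[ℓ]) - c')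
        := by
    intro m
    push_cast
    rw [hc']
    linear_combination hrelT
  -- `|c - c'| ≤ ℓ^{-n}` for every `n`
  have key : ∀ n : ℕ, ‖c - c'‖ ≤ (ℓ : ℝ) ^ (-(n : ℤ)) := by
    intro n
    obtain ⟨m, hm, hmP⟩ := exists_int_norm_sub_eq (W := W) c n
    -- `φ - m` kills `E[ℓ^n]`
    have hkill : ∀ P ∈ geomTorsion W (ℓ ^ n : ℕ), (f - m • AddMonoidHom.id W.geomPoints) P = 0 := by
      intro P hP
      obtain ⟨x, rfl⟩ := proj_surjective_of_isAlgClosed_holds W ℓ n hP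
      rw [AddMonoidHom.sub_apply, sub_eq_zero, ← TateModule.proj_map, hc, LinearMap.smul_apply,
        LinearMap.id_apply, TateModule.proj_smul, ← hmP _ (proj_tateModule_mem_geomTorsion W ℓ n x)]
      rfl
    have hum : f - m • AddMonoidHom.id W.geomPoints ∈ homModule W W
          := sub_mem hfm (Submodule.smul_mem _ _ (id_mem_homModule W))
    -- `deg(φ - m) = d - m t + m²`
    have hdeg : degHom W W (f - m • AddMonoidHom.id W.geomPoints) = d - m * t + m ^ 2 := by
      rw [sub_eq_add_neg, ← neg_smul, degHom_add_zsmul h63 hfm (id_mem_homModule W), degHom_id]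
      rw [ht, hd]; ring
    rcases (mem_homModule_iff_holds W W _).mp hum with h0 | ⟨υ, hυ⟩
    · -- `φ = m`: then `c = m`, `d = m²`, `t = 2m`, so `c' = c`
      have hfm' : f = m • AddMonoidHom.id W.geomPoints := sub_eq_zero.mp h0
      have hcm : c = m := by
        let b := Module.finBasisOfFinrankEq ℤ_[ℓ] (W.tateModule ℓ)
          (finrank_tateModule_eq_two_holds W ℓ hℓ)
        -- `c • b₀ = T_ℓ(φ) b₀ = T_ℓ(m) b₀ = m • b₀`
        have h1 : c • b 0 = (m : ℤ_[ℓ]) • b 0 := by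
          have e1 : c • b 0 = TateModule.map ℓ f (b 0) := by rw [hc]; rfl
          rw [e1, Int.cast_smul_eq_zsmul]
          refine TateModule.ext fun k ↦ ?_
          rw [TateModule.proj_map, _root_.map_zsmul, hfm']
          rfl
        rw [← sub_eq_zero, ← sub_smul] at h1
        exact sub_eq_zero.mp ((smul_eq_zero.mp h1).resolve_right (b.ne_zero 0))
      have ht2 : t = 2 * m := by
        have h1 : degHom W W f = m ^ 2 := by
          rw [hfm', degHom_zsmul h63 (id_mem_homModule W), degHom_id, mul_one]
        have h2 : degHom W W (f + AddMonoidHom.id W.geomPoints) = (m + 1) ^ 2 := by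
          rw [hfm', show m • AddMonoidHom.id W.geomPoints + AddMonoidHom.id W.geomPoints =
              (m + 1) • AddMonoidHom.id W.geomPoints by rw [add_smul, one_smul],
            degHom_zsmul h63 (id_mem_homModule W), degHom_id, mul_one]
        rw [ht, hd, h1, h2]; ring
      have hzero : c - c' = 0 := by
        rw [hc', ht2, hcm]; push_cast; ring
      rw [hzero, norm_zero]
      positivity
    · -- `φ - m` is an isogeny killing `E[ℓ^n]`: `ℓ^{2n} ∣ deg(φ - m)`
      have hdvd : ((ℓ : ℤ) ^ n) ^ 2 ∣ d - m * t + m ^ 2 := by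
        rw [← hdeg, ← hυ, degHom_toAddMonoidHom, ← pow_mul']
        have h1 : Nat.card (geomTorsion W (ℓ ^ n : ℕ)) ∣ Nat.card υ.toAddMonoidHom.ker :=
          AddSubgroup.card_dvd_of_le fun P hP ↦ by
            rw [AddMonoidHom.mem_ker, hυ]; exact hkill P hP
        rw [card_geomTorsion_pow_eq W ℓ (card_torsionPoints_eq_sq_holds W (AlgebraicClosure K)) hℓ]
          at h1
        exact_mod_cast h1.trans (Isogeny.card_ker_dvd_deg_holds υ)
      have hnorm : ‖((d - m * t + m ^ 2 : ℤ) : ℤ_[ℓ])‖ ≤ (ℓ : ℝ) ^ (-((2 * n : ℕ) : ℤ)) := by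
        rw [PadicInt.norm_int_le_pow_iff_dvd]
        rw [pow_mul']; exact_mod_cast hdvd
      rw [hg m, norm_mul, hm] at hnorm
      have hmc' : ‖(m : ℤ_[ℓ]) - c'‖ ≤ (ℓ : ℝ) ^ (-(n : ℤ)) := by
        have hpos : (0 : ℝ) < (ℓ : ℝ) ^ (-(n : ℤ)) := by positivity
        refine le_of_mul_le_mul_left (hnorm.trans_eq ?_) hpos
        rw [← zpow_add₀ (by positivity : (ℓ : ℝ) ≠ 0)]
        congr 1; push_cast; ring
      calc ‖c - c'‖ = ‖-((m : ℤ_[ℓ]) - c) + ((m : ℤ_[ℓ]) - c')‖ := by congr 1; ring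
        _ ≤ max ‖-((m : ℤ_[ℓ]) - c)‖ ‖(m : ℤ_[ℓ]) - c'‖ := PadicInt.nonarchimedean _ _
        _ ≤ (ℓ : ℝ) ^ (-(n : ℤ)) := max_le (by rw [norm_neg, hm]) hmc'
  -- hence `c = c'`
  have hcc' : c = c' := by
    by_contra hne
    have hpos : 0 < ‖c - c'‖ := norm_pos_iff.mpr (sub_ne_zero.mpr hne)
    -- `‖c - c'‖ = ℓ^{-v}`; take `n = v + 1`
    obtain ⟨n, hn⟩ : ∃ n : ℕ, (ℓ : ℝ) ^ (-(n : ℤ)) < ‖c - c'‖ := by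
      have hx : c - c' ≠ 0 := sub_ne_zero.mpr hne
      refine ⟨(c - c').valuation + 1, ?_⟩
      rw [PadicInt.norm_eq_zpow_neg_valuation hx]
      exact zpow_lt_zpow_right₀ hℓ1 (by push_cast; omega)
    exact (lt_irrefl _) ((hn.trans_le (key n)))
  rw [hc'] at hcc'
  refine ⟨?_, ?_⟩
  · linear_combination hcc'
  · have hcast : (φ.deg : ℤ_[ℓ]) = ((d : ℤ) : ℤ_[ℓ]) := by rw [hdφ, Int.cast_natCast]
    rw [hcast]
    linear_combination (-1 : ℤ_[ℓ]) * hrelT + c * hcc'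

end Scalar

/-! ## Prop. III.8.6 from Cor. III.6.3 -/

section Main

variable [W.IsElliptic] {ℓ : ℕ} [Fact ℓ.Prime] (h63 : degHom_isQuadraticForm W W)
include h63

/-- **`tr(φ_ℓ) = deg(φ + 1) - deg φ - 1` and `det(φ_ℓ) = deg φ`** for every `φ ∈ End_K(E)` and
`ℓ ≠ char K`, from Cor. III.6.3 (steps 1–3 of the module docstring). Silverman, *AEC*, Prop. III.8.6
(`det φ_ℓ = deg φ`, `tr φ_ℓ = 1 + deg φ - deg(1 - φ)`; the two forms of the trace agree by the
parallelogram law). [cite: SilvermanAEC2009, Prop. III.8.6] -/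
theorem Isogeny.trace_eq_and_det_eq_of_isQuadraticForm (hℓ : (ℓ : K) ≠ 0) (φ : Isogeny W W) :
    LinearMap.trace ℤ_[ℓ] _ (TateModule.map ℓ φ.toAddMonoidHom) =
        ((degHom W W (φ.toAddMonoidHom + AddMonoidHom.id W.geomPoints)
              - degHom W W φ.toAddMonoidHom - 1 :
          ℤ) : ℤ_[ℓ]) ∧
      LinearMap.det (TateModule.map ℓ φ.toAddMonoidHom) = (φ.deg : ℤ_[ℓ]) := by
  haveI := module_free_tateModule_holds W ℓ
  haveI := module_finite_tateModule_holds W ℓ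
  have hfm : φ.toAddMonoidHom ∈ homModule W W := φ.toAddMonoidHom_mem_homModule
  have hd : degHom W W φ.toAddMonoidHom = φ.deg := degHom_toAddMonoidHom φ
  have hrel := comp_self_sub_smul_add_smul_id_eq_zero h63 hfm
  have hrelT : TateModule.map ℓ φ.toAddMonoidHom * TateModule.map ℓ φ.toAddMonoidHom -
      ((degHom W W (φ.toAddMonoidHom + AddMonoidHom.id W.geomPoints) - degHom W W φ.toAddMonoidHom
        - 1 : ℤ) : ℤ_[ℓ]) • TateModule.map ℓ φ.toAddMonoidHom +
      ((degHom W W φ.toAddMonoidHom : ℤ) : ℤ_[ℓ]) • (1 : W.tateModule ℓ →ₗ[ℤ_[ℓ]] _) = 0 := by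
    exact TateModule.map_mul_map_sub_smul_add_smul_one_eq_zero ℓ hrel
  rcases exists_eq_smul_id_or_trace_eq_and_det_eq W ℓ hℓ _ hrelT with ⟨c, hc⟩ | h
  · obtain ⟨h2c, hc2⟩ := two_mul_eq_and_sq_eq_of_map_eq_smul_id h63 hℓ φ hc
    refine ⟨?_, ?_⟩
    · rw [hc, _root_.map_smul, LinearMap.trace_id, finrank_tateModule_eq_two_holds W ℓ hℓ, ← h2c,
        Nat.cast_ofNat, smul_eq_mul, mul_comm]
    · rw [hc, LinearMap.det_smul, LinearMap.det_id, mul_one,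
        finrank_tateModule_eq_two_holds W ℓ hℓ, hc2]
  · exact ⟨h.1, by rw [h.2, hd, Int.cast_natCast]⟩

omit [W.IsElliptic] in
/-- **Silverman, *AEC*, Prop. III.8.6 (determinant part) from Cor. III.6.3**: the named fact
`Isogeny.det_tateModule_map_eq_deg W ℓ` (`det(φ_ℓ) = deg φ` for `φ ∈ End_K(E)`, `ℓ ≠ char K`)
follows from the named fact `degHom_isQuadraticForm W W` (`deg` is a quadratic form on `End_K(E)`).
[cite: SilvermanAEC2009, Prop. III.8.6 with Cor. III.6.3] -/
theorem Isogeny.det_tateModule_map_eq_deg_of_isQuadraticForm : Isogeny.det_tateModule_map_eq_deg W ℓ :=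
  fun hℓ φ ↦ (Isogeny.trace_eq_and_det_eq_of_isQuadraticForm h63 hℓ φ).2

/-- **Silverman, *AEC*, Prop. III.8.6 (trace part) from Cor. III.6.3**, in the form
`tr(φ_ℓ) = deg(φ + 1) - deg φ - 1`. [cite: SilvermanAEC2009, Prop. III.8.6 with Cor. III.6.3] -/
theorem Isogeny.trace_tateModule_map_eq_of_isQuadraticForm (hℓ : (ℓ : K) ≠ 0) (φ : Isogeny W W) :
    LinearMap.trace ℤ_[ℓ] _ (TateModule.map ℓ φ.toAddMonoidHom) =
      ((degHom W W (φ.toAddMonoidHom + AddMonoidHom.id W.geomPoints)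
            - degHom W W φ.toAddMonoidHom - 1 : ℤ) :
        ℤ_[ℓ]) :=
  (Isogeny.trace_eq_and_det_eq_of_isQuadraticForm h63 hℓ φ).1

end Main

/-! ## The Frobenius facts of `FrobeniusTateModule` (Silverman, *AEC*, Thm. V.2.3.1) from Cor. III.6.3 -/

section Frobenius

variable (W : WeierstrassCurve K) (ℓ : ℕ) [Fact ℓ.Prime]

/-- **`tr(φ_ℓ) = q + 1 - #E(k)` from Cor. III.6.3 and the Weil pairing**: the named fact
`trace_galoisRepTate_frobenius W ℓ` (Silverman, *AEC*, Thm. V.2.3.1) follows from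
`degHom_isQuadraticForm W W` (Cor. III.6.3, giving Prop. III.8.6 at `1 - φ`:
`det(1 - φ_ℓ) = deg(1 - φ)`), the Weil pairings on `E[ℓ^n]` (Prop. III.8.1, `hW`, giving
`det(φ_ℓ) = q`), and the tree's theorems Thm. III.4.10(a) (`Isogeny.card_ker_eq_finSepDegree_holds`)
and Cor. III.5.5 (`isSeparable_oneSubFrobeniusIsogeny_holds`), which give
`deg(1 - φ) = #ker(1 - φ) = #E(k)`. [cite: SilvermanAEC2009, Thm. V.2.3.1 (proof) with Cor. III.6.3 and Prop. III.8.1] -/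
theorem trace_galoisRepTate_frobenius_of_isQuadraticForm (h63 : degHom_isQuadraticForm W W)
    (hW : ∀ n : ℕ, W.exists_weilPairing (ℓ ^ (n + 1))) : W.trace_galoisRepTate_frobenius ℓ := by
  intro _ _ hℓ σ hσ
  exact trace_galoisRepTate_frobenius_of_exists_weilPairing W ℓ hW
    (Isogeny.det_tateModule_map_eq_deg_of_isQuadraticForm h63) (Isogeny.card_ker_eq_finSepDegree_holds W W)
    (isSeparable_oneSubFrobeniusIsogeny_holds W) hℓ σ hσ

/-- **`det(φ_ℓ) = q` from Cor. III.6.3 and Prop. II.2.11(c)** (no Weil pairing): the named fact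
`det_galoisRepTate_frobenius W ℓ` from `degHom_isQuadraticForm W W` (giving `det(φ_ℓ) = deg φ`,
Prop. III.8.6) and `frobeniusIsogeny_deg_eq_card W` (`deg φ = q`, Prop. II.2.11(c)) — Silverman's
own route in the proof of Thm. V.2.3.1. [cite: SilvermanAEC2009, Thm. V.2.3.1 (proof) with Cor. III.6.3 and Prop. II.2.11(c)] -/
theorem det_galoisRepTate_frobenius_of_isQuadraticForm_of_deg (h63 : degHom_isQuadraticForm W W)
    (hdeg : W.frobeniusIsogeny_deg_eq_card) : W.det_galoisRepTate_frobenius ℓ := by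
  intro _ _ hℓ σ hσ
  exact det_galoisRepTate_frobenius_of_deg W ℓ
    (Isogeny.det_tateModule_map_eq_deg_of_isQuadraticForm h63) hdeg hℓ σ hσ

/-- **`tr(φ_ℓ) = q + 1 - #E(k)` from Cor. III.6.3 and Prop. II.2.11(c)** (no Weil pairing): the
named fact `trace_galoisRepTate_frobenius W ℓ` from `degHom_isQuadraticForm W W` and
`frobeniusIsogeny_deg_eq_card W`, with Thm. III.4.10(a) and Cor. III.5.5 supplied by the tree.
[cite: SilvermanAEC2009, Thm. V.2.3.1 (proof) with Cor. III.6.3 and Prop. II.2.11(c)] -/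
theorem trace_galoisRepTate_frobenius_of_isQuadraticForm_of_deg (h63 : degHom_isQuadraticForm W W)
    (hdeg : W.frobeniusIsogeny_deg_eq_card) : W.trace_galoisRepTate_frobenius ℓ := by
  intro _ _ hℓ σ hσ
  exact trace_galoisRepTate_frobenius_of_deg W ℓ
    (Isogeny.det_tateModule_map_eq_deg_of_isQuadraticForm h63) hdeg
    (Isogeny.card_ker_eq_finSepDegree_holds W W) (isSeparable_oneSubFrobeniusIsogeny_holds W) hℓ σ hσ

end Frobenius

end WeierstrassCurve
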